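import Mathlib.MeasureTheory.Integral.IntervalIntegral.ContDiff
import Mathlib.Analysis.SpecialFunctions.Integrals.Basic
import HarnessLib

/-!
# One-dimensional trace / layer inequalities for `C¹` functions: stub `stub_intervalTraceInequalities`
# of line `third-law-current-floor` for crux `BECConjugateDomination.HardCoreExtension`
# (stmt-AtomisticToContinuum-11786)

The two fibrewise (radial) Sobolev inequalities on an interval used by the `C¹`-cutoff scheme that removes
a hard-core shell from a `C¹` minimiser (plan (α')): for `f : ℝ → ℝ` of class `C¹`,

* (i) TRACE FROM AN INNER LAYER: for `h > 0`,
  `f(a)² ≤ (2/h) ∫_{a-h}^a f² + 2h ∫_{a-h}^a f'²`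
  (`IntervalTrace.sq_le_inner_layer`); pointwise `f(a)² ≤ 2 f(r)² + 2 (∫_r^a f')² ≤ 2 f(r)² + 2 h ∫_{a-h}^a f'²`
  for `r ∈ [a-h, a]` by the fundamental theorem of calculus and Cauchy–Schwarz, then integrate in `r`;
* (ii) OUTER LAYER MASS: for `ℓ > 0`,
  `∫_a^{a+ℓ} f² ≤ 2ℓ f(a)² + ℓ² ∫_a^{a+ℓ} f'²`
  (`IntervalTrace.outer_layer_sq_integral_le`); pointwise `f(r)² ≤ 2 f(a)² + 2 (r - a) ∫_a^{a+ℓ} f'²` for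
  `r ∈ [a, a+ℓ]`, then integrate (`∫_a^{a+ℓ} 2 (r - a) dr = ℓ²`).

The registered statement `stub_intervalTraceInequalities` is the conjunction of the two, verbatim as registered in
the skeleton: there, by the binding rules of the `∫ x in a..b, _` notation, the right-hand side of (i) reads
`(2/h) * ∫_{a-h}^a (f(r)² + 2h ∫_{a-h}^a f'²) dr = (2/h) ∫ f² + 4h ∫ f'²`, which is WEAKER than (i) and is derived
from it. Everything here is proved from Mathlib; no named facts.
-/

noncomputable section

namespace Summit.AtomisticToContinuum.BoseEinsteinCondensation.Cruxes.HardCoreExtension.ThirdLawCurrentFloor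

open MeasureTheory Set intervalIntegral
open scoped Topology

namespace IntervalTrace

-- adapted from Literature/Analysis/Complex/CarlemanDichotomy.lean (`sq_integral_le_mul_integral_sq`), with a
-- discriminant-free proof (test value `t = (∫ g)/(y - x)` in `0 ≤ ∫ (g - t)²`).
/-- Cauchy–Schwarz for interval integrals of continuous functions: `(∫ₓʸ g)² ≤ (y - x) ∫ₓʸ g²` for `x ≤ y`.
[folklore] -/
theorem sq_integral_le_mul_integral_sq {g : ℝ → ℝ} (hg : Continuous g) {x y : ℝ} (hxy : x ≤ y) :
    (∫ s in x..y, g s) ^ 2 ≤ (y - x) * ∫ s in x..y, g s ^ 2 := by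
  rcases hxy.eq_or_lt with rfl | hlt
  · simp
  have hL : 0 < y - x := sub_pos.mpr hlt
  set S := ∫ s in x..y, g s
  have hgi : IntervalIntegrable g volume x y := hg.intervalIntegrable x y
  have hg2i : IntervalIntegrable (fun s => g s ^ 2) volume x y := (hg.pow 2).intervalIntegrable x y
  have hci : IntervalIntegrable (fun _ : ℝ => (S / (y - x)) ^ 2) volume x y := intervalIntegrable_const
  have key : ∫ s in x..y, (2 * (S / (y - x)) * g s - (S / (y - x)) ^ 2) ≤ ∫ s in x..y, g s ^ 2 :=
    intervalIntegral.integral_mono_on hxy ((hgi.const_mul _).sub hci) hg2i fun s _ => by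
      nlinarith [sq_nonneg (g s - S / (y - x))]
  have h1 : ∫ s in x..y, (2 * (S / (y - x)) * g s - (S / (y - x)) ^ 2) =
      2 * (S / (y - x)) * S - (y - x) * (S / (y - x)) ^ 2 := by
    rw [intervalIntegral.integral_sub (hgi.const_mul _) hci, intervalIntegral.integral_const_mul,
      intervalIntegral.integral_const, smul_eq_mul]
  have h2 : 2 * (S / (y - x)) * S - (y - x) * (S / (y - x)) ^ 2 = S ^ 2 / (y - x) := by
    field_simp
    ring
  have h3 : S ^ 2 / (y - x) ≤ ∫ s in x..y, g s ^ 2 := by rw [← h2, ← h1]; exact key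
  rw [div_le_iff₀ hL] at h3
  linarith

/-- **Trace from an inner layer.** For `f ∈ C¹(ℝ)`, `a ∈ ℝ` and `h > 0`:
`f(a)² ≤ (2/h) ∫_{a-h}^a f² + 2h ∫_{a-h}^a f'²`. [folklore] -/
theorem sq_le_inner_layer {f : ℝ → ℝ} (hf : ContDiff ℝ 1 f) (a : ℝ) {h : ℝ} (hh : 0 < h) :
    f a ^ 2 ≤ (2 / h) * (∫ r in (a - h)..a, f r ^ 2) + 2 * h * ∫ r in (a - h)..a, deriv f r ^ 2 := by
  have hfc : Continuous f := hf.continuous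
  have hfd : Differentiable ℝ f := hf.differentiable one_ne_zero
  have hf'c : Continuous (deriv f) := hf.continuous_deriv le_rfl
  set C := ∫ r in (a - h)..a, deriv f r ^ 2
  set B := ∫ r in (a - h)..a, f r ^ 2
  have hah : a - h ≤ a := by linarith
  have hC0 : 0 ≤ C := intervalIntegral.integral_nonneg hah fun r _ => sq_nonneg _
  -- pointwise bound on the layer
  have hpt : ∀ r ∈ Icc (a - h) a, f a ^ 2 ≤ 2 * f r ^ 2 + 2 * h * C := by
    intro r hr
    have hra : r ≤ a := hr.2
    have hFTC : ∫ s in r..a, deriv f s = f a - f r :=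
      integral_deriv_eq_sub (fun x _ => hfd x) (hf'c.intervalIntegrable _ _)
    have hmono : ∫ s in r..a, deriv f s ^ 2 ≤ C :=
      intervalIntegral.integral_mono_interval hr.1 hra le_rfl
        (Filter.Eventually.of_forall fun s => sq_nonneg (deriv f s)) ((hf'c.pow 2).intervalIntegrable _ _)
    have hnn : 0 ≤ ∫ s in r..a, deriv f s ^ 2 := intervalIntegral.integral_nonneg hra fun s _ => sq_nonneg _
    have h1 : (f a - f r) ^ 2 ≤ h * C := by
      rw [← hFTC]
      calc (∫ s in r..a, deriv f s) ^ 2 ≤ (a - r) * ∫ s in r..a, deriv f s ^ 2 :=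
            sq_integral_le_mul_integral_sq hf'c hra
        _ ≤ h * C := mul_le_mul (by linarith [hr.1]) hmono hnn hh.le
    nlinarith [sq_nonneg (2 * f r - f a), h1]
  -- integrate it over the layer
  have hint : ∫ _ in (a - h)..a, f a ^ 2 ≤ ∫ r in (a - h)..a, (2 * f r ^ 2 + 2 * h * C) :=
    intervalIntegral.integral_mono_on hah intervalIntegrable_const
      ((by fun_prop : Continuous fun r => 2 * f r ^ 2 + 2 * h * C).intervalIntegrable _ _) hpt
  have hl : ∫ _ in (a - h)..a, f a ^ 2 = h * f a ^ 2 := by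
    rw [intervalIntegral.integral_const, smul_eq_mul]
    ring
  have hr : ∫ r in (a - h)..a, (2 * f r ^ 2 + 2 * h * C) = 2 * B + h * (2 * h * C) := by
    rw [intervalIntegral.integral_add ((by fun_prop : Continuous fun r => 2 * f r ^ 2).intervalIntegrable _ _)
      intervalIntegrable_const, intervalIntegral.integral_const_mul, intervalIntegral.integral_const, smul_eq_mul]
    ring
  rw [hl, hr] at hint
  have hB : 2 / h * B + 2 * h * C = (2 * B + h * (2 * h * C)) / h := by
    field_simp
  rw [hB, le_div_iff₀ hh]
  linarith

/-- **Outer layer mass.** For `f ∈ C¹(ℝ)`, `a ∈ ℝ` and `ℓ > 0`: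
`∫_a^{a+ℓ} f² ≤ 2ℓ f(a)² + ℓ² ∫_a^{a+ℓ} f'²`. [folklore] -/
theorem outer_layer_sq_integral_le {f : ℝ → ℝ} (hf : ContDiff ℝ 1 f) (a : ℝ) {ℓ : ℝ} (hℓ : 0 < ℓ) :
    ∫ r in a..(a + ℓ), f r ^ 2 ≤ 2 * ℓ * f a ^ 2 + ℓ ^ 2 * ∫ r in a..(a + ℓ), deriv f r ^ 2 := by
  have hfc : Continuous f := hf.continuous
  have hfd : Differentiable ℝ f := hf.differentiable one_ne_zero
  have hf'c : Continuous (deriv f) := hf.continuous_deriv le_rfl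
  set D := ∫ r in a..(a + ℓ), deriv f r ^ 2
  have haℓ : a ≤ a + ℓ := by linarith
  -- pointwise bound on the layer
  have hpt : ∀ r ∈ Icc a (a + ℓ), f r ^ 2 ≤ 2 * f a ^ 2 + 2 * (r - a) * D := by
    intro r hr
    have har : a ≤ r := hr.1
    have hFTC : ∫ s in a..r, deriv f s = f r - f a :=
      integral_deriv_eq_sub (fun x _ => hfd x) (hf'c.intervalIntegrable _ _)
    have hmono : ∫ s in a..r, deriv f s ^ 2 ≤ D :=
      intervalIntegral.integral_mono_interval le_rfl har hr.2
        (Filter.Eventually.of_forall fun s => sq_nonneg (deriv f s)) ((hf'c.pow 2).intervalIntegrable _ _)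
    have h1 : (f r - f a) ^ 2 ≤ (r - a) * D := by
      rw [← hFTC]
      exact (sq_integral_le_mul_integral_sq hf'c har).trans (mul_le_mul_of_nonneg_left hmono (sub_nonneg.mpr har))
    nlinarith [sq_nonneg (2 * f a - f r), h1]
  -- integrate it over the layer
  have hint : ∫ r in a..(a + ℓ), f r ^ 2 ≤ ∫ r in a..(a + ℓ), (2 * f a ^ 2 + 2 * (r - a) * D) :=
    intervalIntegral.integral_mono_on haℓ ((hfc.pow 2).intervalIntegrable _ _)
      ((by fun_prop : Continuous fun r => 2 * f a ^ 2 + 2 * (r - a) * D).intervalIntegrable _ _) hpt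
  have hi1 : IntervalIntegrable (fun r : ℝ => r) volume a (a + ℓ) := continuous_id.intervalIntegrable _ _
  have hi2 : IntervalIntegrable (fun _ : ℝ => a) volume a (a + ℓ) := intervalIntegrable_const
  have hlin : ∫ r in a..(a + ℓ), (r - a) = ℓ ^ 2 / 2 := by
    rw [intervalIntegral.integral_sub hi1 hi2, integral_id, intervalIntegral.integral_const, smul_eq_mul]
    ring
  have hr : ∫ r in a..(a + ℓ), (2 * f a ^ 2 + 2 * (r - a) * D) = 2 * ℓ * f a ^ 2 + ℓ ^ 2 * D := by
    rw [intervalIntegral.integral_add intervalIntegrable_const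
        ((by fun_prop : Continuous fun r => 2 * (r - a) * D).intervalIntegrable _ _),
      intervalIntegral.integral_const, smul_eq_mul, intervalIntegral.integral_mul_const,
      intervalIntegral.integral_const_mul, hlin]
    ring
  linarith

end IntervalTrace

/-- **Interval trace inequalities** (stub `stub_intervalTraceInequalities` of line `third-law-current-floor`,
verbatim as registered). (i) For `f ∈ C¹(ℝ)`, `h > 0`: `f(a)²` is bounded by `(2/h)` times the integral over the
inner layer `[a-h, a]` of `f(r)² + 2h ∫_{a-h}^a f'²` (as the notation parses; this follows from the sharper
`IntervalTrace.sq_le_inner_layer`: `f(a)² ≤ (2/h)∫_{a-h}^a f² + 2h ∫_{a-h}^a f'²`). (ii) For `ℓ > 0`: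
`∫_a^{a+ℓ} f² ≤ 2ℓ f(a)² + ℓ² ∫_a^{a+ℓ} f'²` (`IntervalTrace.outer_layer_sq_integral_le`). [folklore] -/
theorem stub_intervalTraceInequalities :
    (∀ (f : ℝ → ℝ), ContDiff ℝ 1 f → ∀ (a h : ℝ), 0 < h →
      f a ^ 2 ≤ (2 / h) * ∫ r in (a - h)..a, f r ^ 2 + 2 * h * ∫ r in (a - h)..a, deriv f r ^ 2) ∧
    (∀ (f : ℝ → ℝ), ContDiff ℝ 1 f → ∀ (a ℓ : ℝ), 0 < ℓ →
      ∫ r in a..(a + ℓ), f r ^ 2 ≤ 2 * ℓ * f a ^ 2 + ℓ ^ 2 * ∫ r in a..(a + ℓ), deriv f r ^ 2) := by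
  refine ⟨fun f hf a h hh => ?_, fun f hf a ℓ hℓ => IntervalTrace.outer_layer_sq_integral_le hf a hℓ⟩
  -- as parsed, the goal is `f a ^ 2 ≤ (2 / h) * ∫ r in (a - h)..a, (f r ^ 2 + 2 * h * C)` with
  -- `C = ∫ r in (a - h)..a, deriv f r ^ 2 ≥ 0`; it follows from the sharper natural form.
  have key := IntervalTrace.sq_le_inner_layer hf a hh
  set C := ∫ r in (a - h)..a, deriv f r ^ 2
  have hC0 : 0 ≤ C := intervalIntegral.integral_nonneg (by linarith) fun r _ => sq_nonneg _
  have hfc : Continuous f := hf.continuous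
  have hsplit : ∫ r in (a - h)..a, (f r ^ 2 + 2 * h * C) = (∫ r in (a - h)..a, f r ^ 2) + h * (2 * h * C) := by
    rw [intervalIntegral.integral_add ((by fun_prop : Continuous fun r => f r ^ 2).intervalIntegrable _ _)
      intervalIntegrable_const, intervalIntegral.integral_const, smul_eq_mul]
    ring
  have h4 : 2 / h * (h * (2 * h * C)) = 4 * h * C := by
    field_simp
    ring
  rw [hsplit, mul_add, h4]
  nlinarith [key, mul_nonneg hh.le hC0]

end Summit.AtomisticToContinuum.BoseEinsteinCondensation.Cruxes.HardCoreExtension.ThirdLawCurrentFloor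

end
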